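import Summits.Ventures.CertifiedManyBodySolver.Downfold.EmeryScaleLeverCheck
import HarnessLib

/-!
# THE CORNER-ANCHORED CHAIN FOR THE SCALE COORDINATE OVER A TYPED BOX: stages (cells covering an axis), their soundness, and the three-stage chains
# from the corners `(Δ₁, a₂, b₂)` (UPPER bound) and `(Δ₂, a₁, b₁)` (LOWER bound) (INFL-3to1-B §B.88 (q)–(s))

Venture CertifiedManyBodySolver, cell `pub/hubbard-downfold` (stage S1; INFLATION-RULES-3to1-B §B.88), seat hubbard-downfold-mod-4 (technique B = band
level, g36); namespace `Summit.Ventures.CertifiedManyBodySolver.Downfold.Emery`. Everything PROVED (0 sorry). WHAT THIS IS NOT: a statement about any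
material; no number lives here; `U = 0` one-body kinematics of the σ model.

OBJECT. `T̃(Δ, a, b) = t_node((Δ, a, b, cP); ε_F(Δ, a, b, cN; ν))` — the fixed-doping scale coordinate with `t_pp′` pinned at `cP` for the hopping and at
`cN` for the Fermi energy (the one-step virtual treatment of `t_pp′`, §B.88 (j): with `cP = c₁`, `cN = c₂` it dominates `T(θ)` on the box from above;
with `cP = c₂`, `cN = c₁` from below). A STAGE is a list of step cells covering one axis from an anchor family; its cells carry their kernel data
(`EmeryScaleLeverCheck.cellCheck`) and an output window for the member's Fermi energy. A CHAIN nests three stages: `t_pd`-axis from the corner, `t_pp`-axis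
from each `t_pd`-cell, `Δ`-axis from each `(t_pd, t_pp)`-cell. `chain_upper`: for every `(Δ, a, b)` in the box, **`T̃(Δ, a, b) ≤ T̃(Δ₁, a₂, b₂)`**;
`chain_lower`: **`T̃(Δ₂, a₁, b₁) ≤ T̃(Δ, a, b)`** — each from ONE anchor-window hypothesis (a point bracket at the corner) and the crude box-wide lower
bound of the Fermi energy (two-corner rule), all other hypotheses being decided by the kernel on the chain data.

Sources: three-band model [HybertsenSchluterChristensen1989, Eq. (1)]; energy-linearised one-band image [AndersenEtAl1995, §6]; interval arithmetic
[folklore] (Moore 1966).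
-/

noncomputable section

namespace Summit.Ventures.CertifiedManyBodySolver.Downfold.Emery

open Real Set Literature.Analysis.ValidatedNumerics.Numerics

/-! ## §1 Cells, stages, bookkeeping -/

/-- One step cell of a stage: step interval, kernel data, bisection depth, member window (hard nesting), output window. [folklore] -/
structure SCell where
  /-- the step interval -/
  iS : FI
  /-- move / rates -/
  cd : CellData
  /-- bisection depth -/
  n : ℕ
  /-- member window for the hard nesting -/
  Wh : FI
  /-- certified window of the member's Fermi energy -/
  Wout : FI

/-- Rate bounding the member's Fermi energy from below: `E_M ≥ E_A + s·(this)`. [folklore] -/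
def memberLo (upper : Bool) (cd : CellData) : FI := if upper then cd.sgP else cd.sgH.neg

/-- Rate bounding the member's Fermi energy from above: `E_M ≤ E_A + s·(this)`. [folklore] -/
def memberHi (upper : Bool) (cd : CellData) : FI := if upper then cd.sgE else cd.sgP

/-- Per-cell test: the kernel cell check on the family box with window `W`, the bookkeeping of directions / pinned `t_pp′` / thin rates with the
sign pattern of `upper_cell` (`σe = −m, σh = ℓ, σp = −ℓ, ℓ ≥ 0`) or `lower_cell` (`σe = σp = u ≥ 0, σh = −m`), the crude member floor `whlo`, and the
output-window containment. [folklore] -/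
def cellOK (upper : Bool) (dD dA dB cN cP : FI) (whlo : ℤ) (famD famA famB W : FI) (c : SCell) : Bool :=
  cellCheck upper c.cd c.n ⟨famD, famA, famB, c.iS, W⟩ c.Wh &&
  decide (c.cd.dD = dD) && decide (c.cd.dA = dA) && decide (c.cd.dB = dB) && decide (c.cd.cN = cN) && decide (c.cd.cP = cP) &&
  decide (c.cd.sgH.lo = c.cd.sgH.hi) && decide (c.cd.sgE.lo = c.cd.sgE.hi) && decide (c.cd.sgP.lo = c.cd.sgP.hi) &&
  (if upper then decide (c.cd.sgP = c.cd.sgH.neg) && decide (0 ≤ c.cd.sgH.lo) && decide (c.Wh.lo ≤ whlo)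
    else decide (c.cd.sgE = c.cd.sgP) && decide (0 ≤ c.cd.sgP.lo)) &&
  decide (c.Wout.lo ≤ ((thin W.lo).add (c.iS.mul (memberLo upper c.cd))).lo) &&
  decide (((thin W.hi).add (c.iS.mul (memberHi upper c.cd))).hi ≤ c.Wout.hi)

/-- The step intervals of a list of cells cover the scaled range `[lo, hi]`. [folklore] -/
def covers (lo hi : ℤ) : List SCell → Bool
  | [] => false
  | c :: rest => decide (c.iS.lo ≤ lo) && (decide (hi ≤ c.iS.hi) || covers c.iS.hi hi rest)

/-- Soundness of `covers`. [folklore] -/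
theorem exists_cell_of_covers : ∀ (L : List SCell) (lo hi : ℤ), covers lo hi L = true →
    ∀ s : ℝ, (lo : ℝ) ≤ s * SC → s * SC ≤ (hi : ℝ) → ∃ c ∈ L, FI.mem s c.iS := by
  intro L
  induction L with
  | nil => intro lo hi h; simp [covers] at h
  | cons c rest ih =>
    intro lo hi h s h1 h2
    simp only [covers, Bool.and_eq_true, Bool.or_eq_true, decide_eq_true_eq] at h
    obtain ⟨hc, hrest⟩ := h
    by_cases hs : s * SC ≤ (c.iS.hi : ℝ)
    · exact ⟨c, by simp, ⟨le_trans (by exact_mod_cast hc) h1, hs⟩⟩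
    · push Not at hs
      rcases hrest with hhi | hrest
      · exfalso
        have : (hi : ℝ) ≤ c.iS.hi := by exact_mod_cast hhi
        linarith
      · obtain ⟨c', hc', hm⟩ := ih _ _ hrest s hs.le h2
        exact ⟨c', by simp [hc'], hm⟩

/-! ## §2 One stage -/

/-- A thin interval equals `thin` of its endpoint. [folklore] -/
theorem eq_thin_of_lo_eq_hi {I : FI} (h : I.lo = I.hi) : I = thin I.lo := by
  cases I with
  | mk lo hi => simp only at h; subst h; rfl

/-- The value `I.lo/SC` lies in a thin `I`. [folklore] -/
theorem mem_val_of_thin {I : FI} (h : I.lo = I.hi) : FI.mem ((I.lo : ℝ) / SC) I := by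
  rw [eq_thin_of_lo_eq_hi h]; exact mem_thin I.lo

/-- `−(k/SC) ∈ (thin k).neg`. [folklore] -/
theorem mem_neg_thin (k : ℤ) : FI.mem (-((k : ℝ) / SC)) (thin k).neg := FI.mem_neg (mem_thin k)

/-- `stageCheck`: every cell passes `cellOK` on the family `(famD, famA, famB)` with window `W`, and the step cells cover `[0, w]`. [folklore] -/
def stageCheck (upper : Bool) (dD dA dB cN cP : FI) (whlo : ℤ) (famD famA famB W : FI) (w : ℤ) (cells : List SCell) : Bool :=
  covers 0 w cells && cells.all (cellOK upper dD dA dB cN cP whlo famD famA famB W)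

section Stage

variable {dD dA dB cN cP : FI} {whlo : ℤ} {famD famA famB W : FI} {w : ℤ} {cells : List SCell} {dΔ da db cNr cPr ν : ℝ}

/-- **STAGE SOUNDNESS, UPPER**: for every anchor `(Δ, a, b)` in the family, every step `0 ≤ s ≤ w/SC`, given the anchor window `ε_F(A, cN) ∈ W` and the
crude floor `whlo/SC ≤ ε_F(M, cN)`: `T̃(M) ≤ T̃(A)` and the member's Fermi energy lies in the output window of a cell containing `s`. [folklore] -/
theorem stage_upper (h : stageCheck true dD dA dB cN cP whlo famD famA famB W w cells = true) (hdD : FI.mem dΔ dD) (hdA : FI.mem da dA)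
    (hdB : FI.mem db dB) (hcN : FI.mem cNr cN) (hcP : FI.mem cPr cP) (hν0 : 0 < ν) (hν1 : ν < 1) {Δ a b s : ℝ} (hD : FI.mem Δ famD)
    (hA : FI.mem a famA) (hB : FI.mem b famB) (hs0 : 0 ≤ s) (hsw : s * SC ≤ (w : ℝ)) (hW : FI.mem (fermiEnergyOf Δ a b cNr ν) W)
    (hcrude : (whlo : ℝ) / SC ≤ fermiEnergyOf (Δ + s * dΔ) (a + s * da) (b + s * db) cNr ν) :
    scaleNodeN (Δ + s * dΔ) (a + s * da) (b + s * db) cPr (fermiEnergyOf (Δ + s * dΔ) (a + s * da) (b + s * db) cNr ν) /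
        scaleNodeD (Δ + s * dΔ) (a + s * da) (b + s * db) cPr (fermiEnergyOf (Δ + s * dΔ) (a + s * da) (b + s * db) cNr ν) ≤
      scaleNodeN Δ a b cPr (fermiEnergyOf Δ a b cNr ν) / scaleNodeD Δ a b cPr (fermiEnergyOf Δ a b cNr ν) ∧
    ∃ c ∈ cells, FI.mem s c.iS ∧ FI.mem (fermiEnergyOf (Δ + s * dΔ) (a + s * da) (b + s * db) cNr ν) c.Wout := by
  simp only [stageCheck, Bool.and_eq_true] at h
  obtain ⟨hcov, hall⟩ := h
  obtain ⟨c, hc, hsc⟩ := exists_cell_of_covers cells 0 w hcov s (by simpa using mul_nonneg hs0 SC_pos.le) hsw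
  have hok := List.all_eq_true.1 hall c hc
  unfold cellOK at hok
  simp only [Bool.and_eq_true, decide_eq_true_eq, ↓reduceIte] at hok
  obtain ⟨⟨⟨⟨⟨⟨⟨⟨⟨⟨⟨hcell, e1⟩, e2⟩, e3⟩, e4⟩, e5⟩, tH⟩, tE⟩, tP⟩, ⟨⟨hsgn, hℓ0⟩, hwhlo⟩⟩, hout1⟩, hout2⟩ := hok
  -- the reals carried by the thin rates
  set ℓ : ℝ := (c.cd.sgH.lo : ℝ) / SC with hℓ
  set m : ℝ := -((c.cd.sgE.lo : ℝ) / SC) with hm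
  have mH : FI.mem ℓ c.cd.sgH := mem_val_of_thin tH
  have mE : FI.mem (-m) c.cd.sgE := by rw [hm, neg_neg]; exact mem_val_of_thin tE
  have mP : FI.mem (-ℓ) c.cd.sgP := by rw [hsgn, eq_thin_of_lo_eq_hi tH]; exact mem_neg_thin _
  have hcd : FI.mem dΔ c.cd.dD ∧ FI.mem da c.cd.dA ∧ FI.mem db c.cd.dB ∧ FI.mem cNr c.cd.cN ∧ FI.mem cPr c.cd.cP ∧ FI.mem (-m) c.cd.sgE ∧
      FI.mem ℓ c.cd.sgH ∧ FI.mem (-ℓ) c.cd.sgP := by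
    refine ⟨?_, ?_, ?_, ?_, ?_, mE, mH, mP⟩
    · rw [e1]; exact hdD
    · rw [e2]; exact hdA
    · rw [e3]; exact hdB
    · rw [e4]; exact hcN
    · rw [e5]; exact hcP
  have hℓ0' : 0 ≤ ℓ := div_nonneg (by exact_mod_cast hℓ0) SC_pos.le
  have hcr : (c.Wh.lo : ℝ) / SC ≤ fermiEnergyOf (Δ + s * dΔ) (a + s * da) (b + s * db) cNr ν :=
    le_trans (div_le_div_of_nonneg_right (by exact_mod_cast hwhlo) SC_pos.le) hcrude
  obtain ⟨hT, hlo, hhi⟩ := upper_cell hcd hℓ0' hν0 hν1 hcell hD hA hB hsc hW hcr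
  refine ⟨hT, c, hc, hsc, fimem_of_mem_Icc ⟨?_, ?_⟩⟩
  · have m1 : FI.mem ((W.lo : ℝ) / SC + s * (-ℓ)) ((thin W.lo).add (c.iS.mul (memberLo true c.cd))) := by
      unfold memberLo; simp only [↓reduceIte]; exact FI.mem_add (mem_thin W.lo) (FI.mem_mul hsc mP)
    have := scaled_le_of_le_lo m1 hout1
    have hWl := (mem_Icc_of_fimem hW).1
    linarith
  · have m2 : FI.mem ((W.hi : ℝ) / SC + s * (-m)) ((thin W.hi).add (c.iS.mul (memberHi true c.cd))) := by
      unfold memberHi; simp only [↓reduceIte]; exact FI.mem_add (mem_thin W.hi) (FI.mem_mul hsc mE)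
    have := le_scaled_of_hi_le m2 hout2
    have hWh := (mem_Icc_of_fimem hW).2
    linarith

/-- **STAGE SOUNDNESS, LOWER**: for every anchor `(Δ, a, b)` in the family, every step `0 ≤ s ≤ w/SC`, given the anchor window and the monotone law
`ε_F(A, cN) ≤ ε_F(M, cN)`: `T̃(A) ≤ T̃(M)` and the member's Fermi energy lies in the output window of a cell containing `s`. [folklore] -/
theorem stage_lower (h : stageCheck false dD dA dB cN cP whlo famD famA famB W w cells = true) (hdD : FI.mem dΔ dD) (hdA : FI.mem da dA)
    (hdB : FI.mem db dB) (hcN : FI.mem cNr cN) (hcP : FI.mem cPr cP) (hν0 : 0 < ν) (hν1 : ν < 1) {Δ a b s : ℝ} (hD : FI.mem Δ famD)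
    (hA : FI.mem a famA) (hB : FI.mem b famB) (hs0 : 0 ≤ s) (hsw : s * SC ≤ (w : ℝ)) (hW : FI.mem (fermiEnergyOf Δ a b cNr ν) W)
    (hmono : fermiEnergyOf Δ a b cNr ν ≤ fermiEnergyOf (Δ + s * dΔ) (a + s * da) (b + s * db) cNr ν) :
    scaleNodeN Δ a b cPr (fermiEnergyOf Δ a b cNr ν) / scaleNodeD Δ a b cPr (fermiEnergyOf Δ a b cNr ν) ≤
      scaleNodeN (Δ + s * dΔ) (a + s * da) (b + s * db) cPr (fermiEnergyOf (Δ + s * dΔ) (a + s * da) (b + s * db) cNr ν) /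
        scaleNodeD (Δ + s * dΔ) (a + s * da) (b + s * db) cPr (fermiEnergyOf (Δ + s * dΔ) (a + s * da) (b + s * db) cNr ν) ∧
    ∃ c ∈ cells, FI.mem s c.iS ∧ FI.mem (fermiEnergyOf (Δ + s * dΔ) (a + s * da) (b + s * db) cNr ν) c.Wout := by
  simp only [stageCheck, Bool.and_eq_true] at h
  obtain ⟨hcov, hall⟩ := h
  obtain ⟨c, hc, hsc⟩ := exists_cell_of_covers cells 0 w hcov s (by simpa using mul_nonneg hs0 SC_pos.le) hsw
  have hok := List.all_eq_true.1 hall c hc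
  unfold cellOK at hok
  simp only [Bool.and_eq_true, decide_eq_true_eq, Bool.false_eq_true, ↓reduceIte] at hok
  obtain ⟨⟨⟨⟨⟨⟨⟨⟨⟨⟨⟨hcell, e1⟩, e2⟩, e3⟩, e4⟩, e5⟩, tH⟩, tE⟩, tP⟩, ⟨hsgn, hu0⟩⟩, hout1⟩, hout2⟩ := hok
  set u : ℝ := (c.cd.sgP.lo : ℝ) / SC with hu
  set m : ℝ := -((c.cd.sgH.lo : ℝ) / SC) with hm
  have mP : FI.mem u c.cd.sgP := mem_val_of_thin tP
  have mE : FI.mem u c.cd.sgE := by rw [hsgn]; exact mP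
  have mH : FI.mem (-m) c.cd.sgH := by rw [hm, neg_neg]; exact mem_val_of_thin tH
  have hcd : FI.mem dΔ c.cd.dD ∧ FI.mem da c.cd.dA ∧ FI.mem db c.cd.dB ∧ FI.mem cNr c.cd.cN ∧ FI.mem cPr c.cd.cP ∧ FI.mem u c.cd.sgE ∧
      FI.mem (-m) c.cd.sgH ∧ FI.mem u c.cd.sgP := by
    refine ⟨?_, ?_, ?_, ?_, ?_, mE, mH, mP⟩
    · rw [e1]; exact hdD
    · rw [e2]; exact hdA
    · rw [e3]; exact hdB
    · rw [e4]; exact hcN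
    · rw [e5]; exact hcP
  have hu0' : 0 ≤ u := div_nonneg (by exact_mod_cast hu0) SC_pos.le
  obtain ⟨⟨hT, hhi⟩, hlo⟩ := lower_cell hcd hu0' hν0 hν1 hcell hD hA hB hsc hW
  have hlo' := hlo hmono
  refine ⟨hT, c, hc, hsc, fimem_of_mem_Icc ⟨?_, ?_⟩⟩
  · have m1 : FI.mem ((W.lo : ℝ) / SC + s * (- -m)) ((thin W.lo).add (c.iS.mul (memberLo false c.cd))) := by
      unfold memberLo; simp only [Bool.false_eq_true, ↓reduceIte]; exact FI.mem_add (mem_thin W.lo) (FI.mem_mul hsc (FI.mem_neg mH))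
    have := scaled_le_of_le_lo m1 hout1
    have hWl := (mem_Icc_of_fimem hW).1
    simp only [neg_neg] at this
    linarith
  · have m2 : FI.mem ((W.hi : ℝ) / SC + s * u) ((thin W.hi).add (c.iS.mul (memberHi false c.cd))) := by
      unfold memberHi; simp only [Bool.false_eq_true, ↓reduceIte]; exact FI.mem_add (mem_thin W.hi) (FI.mem_mul hsc mP)
    have := le_scaled_of_hi_le m2 hout2
    have hWh := (mem_Icc_of_fimem hW).2
    linarith

end Stage

/-! ## §3 The three-stage chains -/

/-- A `t_pp`-cell with its `Δ`-cells. [folklore] -/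
structure BNode where
  /-- the `t_pp` step cell -/
  cell : SCell
  /-- the `Δ` stage anchored on this cell's members -/
  sub : List SCell

/-- A `t_pd`-cell with its `t_pp`-cells. [folklore] -/
structure ANode where
  /-- the `t_pd` step cell -/
  cell : SCell
  /-- the `t_pp` stage anchored on this cell's members -/
  sub : List BNode

/-- The member family along an axis: `base + s·dir` for `s` in the step cell. [folklore] -/
def famOf (base iS dir : FI) : FI := base.add (iS.mul dir)

/-- Membership in `famOf`. [folklore] -/
theorem mem_famOf {base iS dir : FI} {x s d : ℝ} (hx : FI.mem x base) (hs : FI.mem s iS) (hd : FI.mem d dir) :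
    FI.mem (x + s * d) (famOf base iS dir) :=
  FI.mem_add hx (FI.mem_mul hs hd)

/-- `1 ∈ thin SC`, `−1 ∈ thin (−SC)`, `0 ∈ thin 0`. [folklore] -/
theorem mem_dirs : FI.mem (1 : ℝ) (thin (SC : ℤ)) ∧ FI.mem (-1 : ℝ) (thin (-(SC : ℤ))) ∧ FI.mem (0 : ℝ) (thin 0) := by
  refine ⟨mem_of_eq (mem_thin (SC : ℤ)) ?_, mem_of_eq (mem_thin (-(SC : ℤ))) ?_, mem_of_eq (mem_thin 0) ?_⟩
  · push_cast; exact div_self SC_ne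
  · push_cast; rw [neg_div, div_self SC_ne]
  · simp

/-- **`chainCheckUpper`** — the UPPER chain data check: stage `t_pd` (direction `−1`) from the corner families `(ID1, IA2, IB2)` (FI enclosures of `(Δ₁, a₂, b₂)`) with window `W0`, then for
each `t_pd`-cell the stage `t_pp` (direction `−1`) on its members with its output window, then for each `(t_pd, t_pp)`-cell the stage `Δ` (direction
`+1`). [folklore] -/
def chainCheckUpper (cN cP : FI) (whlo : ℤ) (ID1 IA2 IB2 : FI) (wA wB wD : ℤ) (W0 : FI) (nodes : List ANode) : Bool :=
  stageCheck true (thin 0) (thin (-(SC : ℤ))) (thin 0) cN cP whlo ID1 IA2 IB2 W0 wA (nodes.map (·.cell)) &&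
  nodes.all (fun na =>
    stageCheck true (thin 0) (thin 0) (thin (-(SC : ℤ))) cN cP whlo ID1 (famOf IA2 na.cell.iS (thin (-(SC : ℤ)))) IB2
        na.cell.Wout wB (na.sub.map (·.cell)) &&
    na.sub.all (fun nb =>
      stageCheck true (thin (SC : ℤ)) (thin 0) (thin 0) cN cP whlo ID1 (famOf IA2 na.cell.iS (thin (-(SC : ℤ))))
        (famOf IB2 nb.cell.iS (thin (-(SC : ℤ)))) nb.cell.Wout wD nb.sub))

/-- **`chainCheckLower`** — the LOWER chain data check from the corner families `(ID2, IA1, IB1)`: `t_pd` (`+1`), `t_pp` (`+1`), `Δ` (`−1`). [folklore] -/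
def chainCheckLower (cN cP : FI) (ID2 IA1 IB1 : FI) (wA wB wD : ℤ) (W0 : FI) (nodes : List ANode) : Bool :=
  stageCheck false (thin 0) (thin (SC : ℤ)) (thin 0) cN cP 0 ID2 IA1 IB1 W0 wA (nodes.map (·.cell)) &&
  nodes.all (fun na =>
    stageCheck false (thin 0) (thin 0) (thin (SC : ℤ)) cN cP 0 ID2 (famOf IA1 na.cell.iS (thin (SC : ℤ))) IB1
        na.cell.Wout wB (na.sub.map (·.cell)) &&
    na.sub.all (fun nb =>
      stageCheck false (thin (-(SC : ℤ))) (thin 0) (thin 0) cN cP 0 ID2 (famOf IA1 na.cell.iS (thin (SC : ℤ)))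
        (famOf IB1 nb.cell.iS (thin (SC : ℤ))) nb.cell.Wout wD nb.sub))

section Chains

variable {cN cP W0 ID1 IA2 IB2 ID2 IA1 IB1 : FI} {whlo wA wB wD : ℤ} {nodes : List ANode} {cNr cPr ν Δ₁ a₂ b₂ Δ₂ a₁ b₁ : ℝ}

/-- **THE UPPER CHAIN**: for every `(Δ, a, b)` with `Δ₁ ≤ Δ ≤ Δ₁ + wD/SC`, `a₂ − wA/SC ≤ a ≤ a₂`, `b₂ − wB/SC ≤ b ≤ b₂` (`Δ₁ ∈ ID1`, …), given the corner
window `ε_F(Δ₁, a₂, b₂, cN) ∈ W0` and the box-wide floor `whlo/SC ≤ ε_F(·, cN)`: **`T̃(Δ, a, b) ≤ T̃(Δ₁, a₂, b₂)`**. [folklore] -/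
theorem chain_upper (h : chainCheckUpper cN cP whlo ID1 IA2 IB2 wA wB wD W0 nodes = true) (hcN : FI.mem cNr cN) (hcP : FI.mem cPr cP)
    (hD1 : FI.mem Δ₁ ID1) (hA2 : FI.mem a₂ IA2) (hB2 : FI.mem b₂ IB2) (hν0 : 0 < ν) (hν1 : ν < 1) {Δ a b : ℝ} (hΔ1 : Δ₁ ≤ Δ)
    (hΔ2 : (Δ - Δ₁) * SC ≤ (wD : ℝ)) (ha1 : a ≤ a₂) (ha2 : (a₂ - a) * SC ≤ (wA : ℝ)) (hb1 : b ≤ b₂) (hb2 : (b₂ - b) * SC ≤ (wB : ℝ))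
    (hW0 : FI.mem (fermiEnergyOf Δ₁ a₂ b₂ cNr ν) W0)
    (hcrude : ∀ Δ' a' b' : ℝ, Δ₁ ≤ Δ' → Δ' ≤ Δ → a ≤ a' → a' ≤ a₂ → b ≤ b' → b' ≤ b₂ → (whlo : ℝ) / SC ≤ fermiEnergyOf Δ' a' b' cNr ν) :
    scaleNodeN Δ a b cPr (fermiEnergyOf Δ a b cNr ν) / scaleNodeD Δ a b cPr (fermiEnergyOf Δ a b cNr ν) ≤
      scaleNodeN Δ₁ a₂ b₂ cPr (fermiEnergyOf Δ₁ a₂ b₂ cNr ν) / scaleNodeD Δ₁ a₂ b₂ cPr (fermiEnergyOf Δ₁ a₂ b₂ cNr ν) := by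
  obtain ⟨h1, hm1, h0⟩ := mem_dirs
  simp only [chainCheckUpper, Bool.and_eq_true] at h
  obtain ⟨hA, hrest⟩ := h
  -- stage A: a = a₂ + sA·(−1)
  set sA := a₂ - a with hsA
  have hsA0 : 0 ≤ sA := by rw [hsA]; linarith
  have eA : a₂ + -sA = a := by rw [hsA]; ring
  have stA := stage_upper hA h0 hm1 h0 hcN hcP hν0 hν1 hD1 hA2 hB2 hsA0 ha2 hW0 (by
    simp only [mul_zero, add_zero, mul_neg, mul_one, eA]
    exact hcrude _ a _ le_rfl hΔ1 le_rfl ha1 hb1 le_rfl)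
  simp only [mul_zero, add_zero, mul_neg, mul_one, eA] at stA
  obtain ⟨hTA, cA, hcA, hscA, hWA⟩ := stA
  obtain ⟨na, hna, rfl⟩ := List.mem_map.1 hcA
  have hB := (List.all_eq_true.1 hrest na hna)
  simp only [Bool.and_eq_true] at hB
  obtain ⟨hB, hrestB⟩ := hB
  -- stage B: b = b₂ + sB·(−1)
  set sB := b₂ - b with hsB
  have hsB0 : 0 ≤ sB := by rw [hsB]; linarith
  have eB : b₂ + -sB = b := by rw [hsB]; ring
  have ma : FI.mem a (famOf IA2 na.cell.iS (thin (-(SC : ℤ)))) := by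
    have := mem_famOf hA2 hscA hm1; simp only [mul_neg, mul_one, eA] at this; exact this
  have stB := stage_upper hB h0 h0 hm1 hcN hcP hν0 hν1 hD1 ma hB2 hsB0 hb2 hWA (by
    simp only [mul_zero, add_zero, mul_neg, mul_one, eB]
    exact hcrude _ a b le_rfl hΔ1 le_rfl ha1 le_rfl hb1)
  simp only [mul_zero, add_zero, mul_neg, mul_one, eB] at stB
  obtain ⟨hTB, cB, hcB, hscB, hWB⟩ := stB
  obtain ⟨nb, hnb, rfl⟩ := List.mem_map.1 hcB
  have hC := List.all_eq_true.1 hrestB nb hnb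
  -- stage C: Δ = Δ₁ + sD·1
  set sD := Δ - Δ₁ with hsD
  have hsD0 : 0 ≤ sD := by rw [hsD]; linarith
  have eD : Δ₁ + sD = Δ := by rw [hsD]; ring
  have mb : FI.mem b (famOf IB2 nb.cell.iS (thin (-(SC : ℤ)))) := by
    have := mem_famOf hB2 hscB hm1; simp only [mul_neg, mul_one, eB] at this; exact this
  have stC := stage_upper hC h1 h0 h0 hcN hcP hν0 hν1 hD1 ma mb hsD0 hΔ2 hWB (by
    simp only [mul_zero, add_zero, mul_one, eD]
    exact hcrude Δ a b hΔ1 le_rfl le_rfl ha1 le_rfl hb1)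
  simp only [mul_zero, add_zero, mul_one, eD] at stC
  obtain ⟨hTC, -⟩ := stC
  exact hTC.trans (hTB.trans hTA)

/-- **THE LOWER CHAIN**: for every `(Δ, a, b)` with `Δ₂ − wD/SC ≤ Δ ≤ Δ₂`, `a₁ ≤ a ≤ a₁ + wA/SC`, `b₁ ≤ b ≤ b₁ + wB/SC` (`Δ₂ ∈ ID2`, …; `Δ > 0`,
`a₁ > 0`, `b₁ ≥ 0`, `cN ≥ 0`), given the corner window `ε_F(Δ₂, a₁, b₁, cN) ∈ W0`: **`T̃(Δ₂, a₁, b₁) ≤ T̃(Δ, a, b)`**. [folklore] -/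
theorem chain_lower (h : chainCheckLower cN cP ID2 IA1 IB1 wA wB wD W0 nodes = true) (hcN : FI.mem cNr cN) (hcP : FI.mem cPr cP)
    (hD2 : FI.mem Δ₂ ID2) (hA1 : FI.mem a₁ IA1) (hB1 : FI.mem b₁ IB1) (hcN0 : 0 ≤ cNr) (hν0 : 0 < ν) (hν1 : ν < 1) {Δ a b : ℝ} (hΔpos : 0 < Δ)
    (ha1pos : 0 < a₁) (hb1nn : 0 ≤ b₁) (hΔ1 : Δ ≤ Δ₂) (hΔ2 : (Δ₂ - Δ) * SC ≤ (wD : ℝ)) (ha1 : a₁ ≤ a) (ha2 : (a - a₁) * SC ≤ (wA : ℝ))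
    (hb1 : b₁ ≤ b) (hb2 : (b - b₁) * SC ≤ (wB : ℝ)) (hW0 : FI.mem (fermiEnergyOf Δ₂ a₁ b₁ cNr ν) W0) :
    scaleNodeN Δ₂ a₁ b₁ cPr (fermiEnergyOf Δ₂ a₁ b₁ cNr ν) / scaleNodeD Δ₂ a₁ b₁ cPr (fermiEnergyOf Δ₂ a₁ b₁ cNr ν) ≤
      scaleNodeN Δ a b cPr (fermiEnergyOf Δ a b cNr ν) / scaleNodeD Δ a b cPr (fermiEnergyOf Δ a b cNr ν) := by
  obtain ⟨h1, hm1, h0⟩ := mem_dirs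
  have hΔ2pos : 0 < Δ₂ := lt_of_lt_of_le hΔpos hΔ1
  simp only [chainCheckLower, Bool.and_eq_true] at h
  obtain ⟨hA, hrest⟩ := h
  -- monotone law from the two-corner rule on degenerate boxes
  have mono : ∀ {D D' x x' y y' : ℝ}, 0 < D' → D' ≤ D → 0 < x → x ≤ x' → 0 ≤ y → y ≤ y' →
      fermiEnergyOf D x y cNr ν ≤ fermiEnergyOf D' x' y' cNr ν := by
    intro D D' x x' y y' hD' hDD hx hxx hy hyy
    have := fermiEnergyOf_mem_Icc_of_mem_box' (Δ := D') (a := x') (b := y') (c := cNr) hD' hx hy hcN0 ⟨le_rfl, hDD⟩ ⟨hxx, le_rfl⟩ ⟨hyy, le_rfl⟩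
      ⟨le_rfl, le_rfl⟩ hν0 hν1
    exact this.1
  -- stage A: a = a₁ + sA·1
  set sA := a - a₁ with hsA
  have hsA0 : 0 ≤ sA := by rw [hsA]; linarith
  have eA : a₁ + sA = a := by rw [hsA]; ring
  have stA := stage_lower hA h0 h1 h0 hcN hcP hν0 hν1 hD2 hA1 hB1 hsA0 ha2 hW0 (by
    simp only [mul_zero, add_zero, mul_one, eA]
    exact mono hΔ2pos le_rfl ha1pos ha1 hb1nn le_rfl)
  simp only [mul_zero, add_zero, mul_one, eA] at stA
  obtain ⟨hTA, cA, hcA, hscA, hWA⟩ := stA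
  obtain ⟨na, hna, rfl⟩ := List.mem_map.1 hcA
  have hB := (List.all_eq_true.1 hrest na hna)
  simp only [Bool.and_eq_true] at hB
  obtain ⟨hB, hrestB⟩ := hB
  -- stage B: b = b₁ + sB·1
  set sB := b - b₁ with hsB
  have hsB0 : 0 ≤ sB := by rw [hsB]; linarith
  have eB : b₁ + sB = b := by rw [hsB]; ring
  have hapos : 0 < a := lt_of_lt_of_le ha1pos ha1
  have ma : FI.mem a (famOf IA1 na.cell.iS (thin (SC : ℤ))) := by
    have := mem_famOf hA1 hscA h1; simp only [mul_one, eA] at this; exact this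
  have stB := stage_lower hB h0 h0 h1 hcN hcP hν0 hν1 hD2 ma hB1 hsB0 hb2 hWA (by
    simp only [mul_zero, add_zero, mul_one, eB]
    exact mono hΔ2pos le_rfl hapos le_rfl hb1nn hb1)
  simp only [mul_zero, add_zero, mul_one, eB] at stB
  obtain ⟨hTB, cB, hcB, hscB, hWB⟩ := stB
  obtain ⟨nb, hnb, rfl⟩ := List.mem_map.1 hcB
  have hC := List.all_eq_true.1 hrestB nb hnb
  -- stage C: Δ = Δ₂ + sD·(−1)
  set sD := Δ₂ - Δ with hsD
  have hsD0 : 0 ≤ sD := by rw [hsD]; linarith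
  have eD : Δ₂ + -sD = Δ := by rw [hsD]; ring
  have hbnn : 0 ≤ b := le_trans hb1nn hb1
  have mb : FI.mem b (famOf IB1 nb.cell.iS (thin (SC : ℤ))) := by
    have := mem_famOf hB1 hscB h1; simp only [mul_one, eB] at this; exact this
  have stC := stage_lower hC hm1 h0 h0 hcN hcP hν0 hν1 hD2 ma mb hsD0 hΔ2 hWB (by
    simp only [mul_zero, add_zero, mul_neg, mul_one, eD]
    exact mono hΔpos hΔ1 hapos le_rfl hbnn le_rfl)
  simp only [mul_zero, add_zero, mul_neg, mul_one, eD] at stC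
  obtain ⟨hTC, -⟩ := stC
  exact hTA.trans (hTB.trans hTC)

end Chains

end Summit.Ventures.CertifiedManyBodySolver.Downfold.Emery
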